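import Summits.NavierStokesRegularity.FluidComputer.ChainField
import Literature.Analysis.ODE.GlobalExistence
import Literature.Analysis.ODE.ConfinedAutonomous
import HarnessLib

/-!
# The exact circuit has a global flow (layer R, exact class; `pub-fluidc-bp3/R1-DESIGN.md` §11.9)

HONEST FRAMING (cell `pub-fluidc`, blueprint seat bp3, gen 22): low prior, high value-of-information
experiment on Tao's machine paradigm; NOT a claim that NS blows up.

WHAT. The chain field `ChainField.F g Λ` is a homogeneous quadratic vector field on `ℝ⁹` that
CONSERVES `∑ Xᵢ²` (`ChainField.energy`). Pure analysis, no data: such a field is smooth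
(`contDiff_F`), every solution keeps `∑ Xᵢ²` constant (`CircuitFlow.sum_sq_eq`, so the sup norm
stays below `√(∑ X₀ᵢ²)`), hence the continuation principle in a-priori-bound form
(`Literature.Analysis.ODE.exists_solution_Ici_of_apriori_bound`, with the Lipschitz-on-balls input
from `exists_lipschitzOnWith_of_isCompact`) gives a solution on `[0, ∞)`; the same for `−Φ`, glued
at `0`, gives a solution on all of `ℝ` (`exists_solution_real`, `circuit_solution`). This is the
trajectory that `RowCircuit.lean` feeds to `RowChain.enclosure`.

[cite: Tao2016AveragedNS, §5.5 Thm 5.3 (5.5)]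
-/

noncomputable section

namespace Summit.NavierStokesRegularity.FluidComputer

open Literature.Analysis.FluidPDE.FluidComputer Literature.Analysis.ODE Set Metric Filter Topology

open scoped NNReal BigOperators

namespace ChainField

/-- The chain field is smooth (it is polynomial). [folklore] -/
theorem contDiff_F (g : GateData) (Λ : ℝ) {n : WithTop ℕ∞} : ContDiff ℝ n (F g Λ) := by
  rw [contDiff_pi]
  intro i
  fin_cases i <;> simp [F] <;> fun_prop

/-- [folklore] -/
theorem continuous_F (g : GateData) (Λ : ℝ) : Continuous (F g Λ) :=
  (contDiff_F g Λ (n := 0)).continuous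

end ChainField

namespace CircuitFlow

variable {n : ℕ}

/-- The sup norm is below the Euclidean one. [folklore] -/
theorem norm_le_sqrt_sum_sq (x : Fin n → ℝ) : ‖x‖ ≤ Real.sqrt (∑ i, x i ^ 2) := by
  refine (pi_norm_le_iff_of_nonneg (Real.sqrt_nonneg _)).2 fun i => ?_
  rw [Real.norm_eq_abs]
  exact Real.abs_le_sqrt (Finset.single_le_sum (fun j _ => sq_nonneg (x j)) (Finset.mem_univ i))

/-- **Energy conservation**: along a solution of `β' = Φ(β)` on `[a, s]` (derivative-within
convention) of a field with `∑ Xᵢ Φᵢ(X) = 0`, `∑ βᵢ²` is constant. [folklore] -/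
theorem sum_sq_eq {Φ : (Fin n → ℝ) → (Fin n → ℝ)} (hΦ : ∀ X, ∑ i, X i * Φ X i = 0)
    {β : ℝ → Fin n → ℝ} {a s : ℝ}
    (hβ : ∀ t ∈ Icc a s, HasDerivWithinAt β (Φ (β t)) (Icc a s) t) :
    ∀ t ∈ Icc a s, ∑ i, β t i ^ 2 = ∑ i, β a i ^ 2 := by
  have hcont : ContinuousOn β (Icc a s) := fun t ht => (hβ t ht).continuousWithinAt
  have hfc : ContinuousOn (fun t => ∑ i, β t i * β t i) (Icc a s) :=
    continuousOn_finsetSum _ fun i _ =>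
      ((continuous_apply i).comp_continuousOn hcont).mul
        ((continuous_apply i).comp_continuousOn hcont)
  have hder : ∀ t ∈ Ico a s, HasDerivWithinAt (fun t => ∑ i, β t i * β t i) 0 (Ici t) t := by
    intro t ht
    have hβt : HasDerivWithinAt β (Φ (β t)) (Ici t) t :=
      (hβ t (Ico_subset_Icc_self ht)).mono_of_mem_nhdsWithin
        (mem_of_superset (Icc_mem_nhdsGE ht.2) (Icc_subset_Icc ht.1 le_rfl))
    have h := HasDerivWithinAt.fun_sum (u := Finset.univ)
      fun i _ => ((hasDerivWithinAt_pi.1 hβt) i).mul ((hasDerivWithinAt_pi.1 hβt) i)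
    refine h.congr_deriv ?_
    calc ∑ i ∈ Finset.univ, (Φ (β t) i * β t i + β t i * Φ (β t) i)
        = 2 * ∑ i, β t i * Φ (β t) i := by
          rw [Finset.mul_sum]
          exact Finset.sum_congr rfl fun i _ => by ring
      _ = 0 := by rw [hΦ, mul_zero]
  intro t ht
  simpa only [sq] using constant_of_has_deriv_right_zero hfc hder t ht

/-- **Forward global existence** for an energy-conserving `C¹` field on `ℝⁿ`. [folklore] -/
theorem exists_solution_Ici {Φ : (Fin n → ℝ) → (Fin n → ℝ)} (hΦc : ContDiff ℝ 1 Φ)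
    (hΦ : ∀ X, ∑ i, X i * Φ X i = 0) (q₀ : Fin n → ℝ) :
    ∃ α : ℝ → Fin n → ℝ, α 0 = q₀ ∧ (∀ t, 0 ≤ t → HasDerivWithinAt α (Φ (α t)) (Ici 0) t) ∧
      ∀ t, 0 < t → HasDerivAt α (Φ (α t)) t := by
  have hlip : ∀ T ρ : ℝ, ∃ K : ℝ≥0, ∀ t ∈ Icc 0 T, LipschitzOnWith K Φ (closedBall 0 ρ) := by
    intro T ρ
    obtain ⟨C, hC⟩ := exists_lipschitzOnWith_of_isCompact isOpen_univ hΦc.contDiffOn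
      (isCompact_closedBall (0 : Fin n → ℝ) ρ) (subset_univ _)
    exact ⟨C, fun _ _ => hC⟩
  have hapriori : ∀ T : ℝ, 0 ≤ T → ∃ R : ℝ, ‖q₀‖ ≤ R ∧ ∀ s ∈ Icc 0 T, ∀ β : ℝ → Fin n → ℝ,
      β 0 = q₀ → (∀ t ∈ Icc 0 s, HasDerivWithinAt β (Φ (β t)) (Icc 0 s) t) →
      ∀ t ∈ Icc 0 s, ‖β t‖ ≤ R := by
    intro T _
    refine ⟨Real.sqrt (∑ i, q₀ i ^ 2), norm_le_sqrt_sum_sq q₀, fun s _ β hβ0 hβ t ht => ?_⟩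
    have h := sum_sq_eq hΦ hβ t ht
    rw [hβ0] at h
    rw [← h]
    exact norm_le_sqrt_sum_sq (β t)
  obtain ⟨α, h0, -, hIci, hpos⟩ := exists_solution_Ici_of_apriori_bound (v := fun _ => Φ)
    (x₀ := q₀) hlip (fun _ => continuousOn_const) hapriori
  exact ⟨α, h0, hIci, hpos⟩

/-- **Global existence on `ℝ`** for an energy-conserving `C¹` field on `ℝⁿ` (forward solutions of
`Φ` and of `−Φ`, glued at `t = 0`, as in
`Literature.Analysis.ODE.exists_solution_real_of_lipschitz`). [folklore] -/
theorem exists_solution_real {Φ : (Fin n → ℝ) → (Fin n → ℝ)} (hΦc : ContDiff ℝ 1 Φ)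
    (hΦ : ∀ X, ∑ i, X i * Φ X i = 0) (q₀ : Fin n → ℝ) :
    ∃ α : ℝ → Fin n → ℝ, α 0 = q₀ ∧ ∀ t, HasDerivAt α (Φ (α t)) t := by
  obtain ⟨αp, h0p, hIcip, hposp⟩ := exists_solution_Ici hΦc hΦ q₀
  have hΦn : ∀ X, ∑ i, X i * (-Φ X) i = 0 := fun X => by
    simp only [Pi.neg_apply, mul_neg, Finset.sum_neg_distrib, hΦ X, neg_zero]
  obtain ⟨αm, h0m, hIcim, hposm⟩ := exists_solution_Ici hΦc.neg hΦn q₀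
  refine ⟨fun t => if 0 ≤ t then αp t else (αm ∘ Neg.neg) t, by simp [h0p], fun t => ?_⟩
  show HasDerivAt _ (Φ (if 0 ≤ t then αp t else (αm ∘ Neg.neg) t)) t
  rcases lt_trichotomy t 0 with ht | rfl | ht
  · have hev : (fun s => if 0 ≤ s then αp s else (αm ∘ Neg.neg) s) =ᶠ[𝓝 t] (αm ∘ Neg.neg) := by
      filter_upwards [Iio_mem_nhds ht] with s hs
      rw [if_neg (not_le.2 hs)]
    have hd : HasDerivAt (αm ∘ Neg.neg) (Φ ((αm ∘ Neg.neg) t)) t := by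
      have h1 := hposm (-t) (by linarith)
      have h2 := h1.scomp t (hasDerivAt_neg (x := t))
      rw [neg_smul, one_smul, neg_neg] at h2
      exact h2
    rw [if_neg (not_le.2 ht)]
    exact hd.congr_of_eventuallyEq hev
  · rw [if_pos le_rfl, h0p]
    have hr : HasDerivWithinAt (fun s => if 0 ≤ s then αp s else (αm ∘ Neg.neg) s) (Φ q₀)
        (Ici 0) 0 := by
      have h1 := hIcip 0 le_rfl
      rw [h0p] at h1
      exact h1.congr (fun s hs => by rw [if_pos (mem_Ici.1 hs)]) (by simp [h0p])
    have hl : HasDerivWithinAt (fun s => if 0 ≤ s then αp s else (αm ∘ Neg.neg) s) (Φ q₀)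
        (Iic 0) 0 := by
      have h1 := hIcim 0 le_rfl
      rw [h0m] at h1
      have h2 : HasDerivWithinAt (αm ∘ Neg.neg) ((-1 : ℝ) • -Φ q₀) (Iic 0) 0 :=
        h1.scomp_of_eq (0 : ℝ) (hasDerivWithinAt_neg (x := (0 : ℝ)) (s := Iic 0))
          (fun s hs => mem_Ici.2 (neg_nonneg.2 (mem_Iic.1 hs))) neg_zero.symm
      rw [neg_smul, one_smul, neg_neg] at h2
      refine h2.congr (fun s hs => ?_) (by simp [h0p, h0m])
      rcases (mem_Iic.1 hs).lt_or_eq with hs' | rfl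
      · rw [if_neg (not_le.2 hs')]
      · simp [h0p, h0m]
    have := hl.union hr
    rwa [Iic_union_Ici, hasDerivWithinAt_univ] at this
  · have hev : (fun s => if 0 ≤ s then αp s else (αm ∘ Neg.neg) s) =ᶠ[𝓝 t] αp := by
      filter_upwards [Ioi_mem_nhds ht] with s hs
      rw [if_pos (le_of_lt hs)]
    rw [if_pos ht.le]
    exact (hposp t ht).congr_of_eventuallyEq hev

/-- **The exact circuit has a global solution through every state.** [folklore] -/
theorem circuit_solution (g : GateData) (Λ : ℝ) (q₀ : Fin 9 → ℝ) :
    ∃ y : ℝ → Fin 9 → ℝ, y 0 = q₀ ∧ ∀ t, HasDerivAt y (ChainField.F g Λ (y t)) t :=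
  exists_solution_real (ChainField.contDiff_F g Λ) (fun X => ChainField.energy g Λ X) q₀

end CircuitFlow

end Summit.NavierStokesRegularity.FluidComputer
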